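import Literature.MathematicalPhysics.QuantumFieldTheory.Balaban1983to89.B15BasicStep

/-!
# N21 (NE7c) — module 38a «THE HYBRID RESAMPLING LIFT» (LENS nearmiss v20.0 ROW Y″, Cards 56∕57; Sketch-g20 §H + §C): the history-space lift of one ℝ-send
# under which 20n `shellWeightBound_histories_of_resamplingTower`'s `hNA`∕`hoffA`∕`hmassA` are Fubini identities (37 §3 lifted to histories), whose
# older-integral is def-R's `rstepOfSel` term, and whose `honA` is the printed quotient bound; and the count `δr := (1+q̄)^{ν̄} − 1`, K-uniform by `LiveWindow.count`

PROVENANCE AND CREDIT.  This module is the planner seat `ym-lens-BalabanUVNodes-nearmiss`'s `Sketch-nearmiss-g20.lean` §H + §C (typed companion of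
`LENS-nearmiss.md` v20.0 sha16 6dbb3b64e6577a82, Cards 56∕57, FAN-OUT ROW Y″ «dag-n21-e successor first refusal», bus l.21563; sketch sha16 f6d89b57bc34cea4,
md5-16 953dd9e57f465b5d, farm rc 0) landed VERBATIM by seat `pub-ymgap-dag-n21-e` (g12); only this header, the namespace and four one-line docstrings (gate
lint) are the filer's; authorship of the mathematics: the lens.  Lane: `--kind definition --supports stmt-QuantumFields-20544 --as helper`
(K3⁷ `SpineGivenEndpointR13SepCoPH`).  Count-neutral.  Consumers: modules 38b `…N21HistoriesLiftedStageLaws` (one lifted ℝ-stage; the support-proviso editions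
of (L1)∕(L4)∕(L5)) and 38c `…N21HistoriesHybridLiftTower` (20n BY NAME over lifted densities, its eight stage-law binders discharged).

THE MEASURED NEAR-MISS (lens g20, abridged).  def-R's (2.18)-terms `χ·TexpA : Density P k G` are functions of the CURRENT field only (older levels are
integrated inside `TexpA`), so print's ℝ-quotient `rratio` (def-R FILE 7; n21-e 20–23) lives on ONE level; the history space that module 20n
(`…N21HistoriesResamplingTower`) needs carries ALL levels at once, and there the ℝ-step must be LIFTED.  THE HYBRID RESAMPLING LIFT of one ℝ-send
`a ↦ b` (sender density `a`, receiver density `b`, both functions of all coordinates of a finite product space `Π i, X i` with product reference law;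
`O` = the OLDER coordinates, `F` = the conditional-integration fibre of the send, disjoint): `hybridLift μ O F b a := ρ_b · (∫⋯∫⁻_F a) ∕ (∫⋯∫⁻_F ρ_b)`,
`ρ_b := ∫⋯∫⁻_O b` — older coordinates keep the SENDER's law, the fibre variables are resampled from the RECEIVER's current-level conditional law.
(L1) its `F`-integral is the sender's (b01's `lmarginal_norm_term`), hence (N): EVERY statistic not reading the fibre keeps the sender's law EXACTLY
(`map_hybridLift_eq_of_notRead` — 20n's `hN` for past statistics and `hoff` for same-level statistics off the fibre); (L2) its `O`-integral is the
PRINTED ℝ-term `ρ_b·(∫_{O∪F} a)∕(∫_{O∪F} b)` (def-R `rstepOfSel` ∕ b01 `normTerm` shadow); (L3) a statistic of the current level (not reading `O`) is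
dominated by `q̄ ×` the receiver's law, `q̄` any pointwise bound of the PRINTED quotient (`map_hybridLift_le_of_notReadOlder` — 20n's `hon`); (L4) mass
= the sender's (`lintegral_hybridLift` — 20n's `hmass`); (L5) a forward-kernel factor `Φ` of fibrewise mass one over the YOUNGER coordinates is invisible
to every statistic of levels `≤ k` (`lintegral_mul_fwd_eq`, `lintegral_hybridLift_fwd_mul_of_indepOf`) — the instantiation recipe on `Π_{j ≤ K}` (level-`j`
bond variables, product Haar): lift `= hybridLift μ O F b a · Φ` with `a`, `b` TRUNCATED at level `k` (applying the lift to the untruncated `a·Φ`, `b·Φ`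
is wrong — lens census yyyyyy).

§C (lens Card 57).  `senderCharge_eq`∕`senderCharge_le_pow(')`: `Σ_{∅≠S⊆U} Π_{i∈S} q i = Π_{i∈U}(1+q i) − 1 ≤ (1+q̄)^n − 1` — one live level's
multi-component sender charge is K-uniform by COUNTING (`n = ν̄ = v₀Λ^{N₁}`, `T4ShellMeasureLevels.LiveWindow.count`), no locality input; this is 20n's `δr`.

HONEST FRAMING.  [textbook] measure theory on finite products (Mathlib `lmarginal`) + [folklore] bookkeeping + counting; 2 defs (`hybridLift`, `NotRead`),
0 sorry; NOTHING of Bałaban's is asserted (context only: [Balaban1989LargeFieldI] (0.3)–(0.4) p. 176); the denominators' non-vanishing `h0`∕`htop` are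
DISPLAYED (at indicator-carrying receivers of record b01's `hden ∀V` is not satisfiable as such — 38b re-issues (L1)∕(L1′)∕(L4)∕(L5) under the weaker SUPPORT
proviso «denominator `= 0 ⇒` the sender's fibre integral `= 0`», n21-e 20 §4's cure); NE7c ((M1) at the live slots) is NOT PRINTED and NOT PROVED; N21 NOT discharged; count-neutral; one finite 𝕋⁴ at fixed ε —
nothing about ℝ⁴ ∕ OS ∕ mass gap ∕ Clay.

CITATION HEADER (lean-in-tree rule).  BY NAME: b01 `B15.BasicStep.lmarginal_norm_term` ∕ `indepOf_lmarginal` ∕ `lmarginal_mul_of_indepOf` ∕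
`lintegral_eq_of_lmarginal_eq` ∕ `lintegral_le_of_lmarginal_le` ∕ `lmarginal_of_indepOf` ∕ `IndepOf`; Mathlib `lmarginal_union` ∕ `lmarginal_union'`.
-/

set_option autoImplicit false

open MeasureTheory Set Finset
open scoped BigOperators ENNReal
open Literature.MathematicalPhysics.QuantumFieldTheory.Balaban1983to89.B15.BasicStep

namespace Summit.QuantumFields.YangMills.Theorems.N21HybridResamplingLift

/-! ## §H  Card 56 — the hybrid resampling lift on one product space -/

section HybridLift

variable {ι : Type*} [DecidableEq ι] {X : ι → Type*} [∀ i, MeasurableSpace (X i)]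
  {μ : ∀ i, Measure (X i)} [∀ i, IsProbabilityMeasure (μ i)]

variable (μ) in
/-- **THE HYBRID RESAMPLING LIFT** of one ℝ-send `a ↦ b` (sender density `a`, receiver density `b`, both functions of ALL coordinates
of the history space; `O` = the OLDER coordinates, `F` = the conditional-integration fibre of the send, disjoint): the receiver's
current-level density `ρ_b = ∫⋯∫⁻_O b` renormalised on the fibre by the sender's fibre integral TAKEN POINTWISE IN THE OLDER
COORDINATES — older coordinates keep the sender's law, fibre variables are resampled from the receiver's current-level conditional
law (older marginalised).  Cf. module 20n's header «keep the term's law OFF the fibre, RESAMPLE the fibre variables from the receiving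
term's conditional law». [folklore] -/
noncomputable def hybridLift (O F : Finset ι) (b a : (∀ i, X i) → ℝ≥0∞) : (∀ i, X i) → ℝ≥0∞ :=
  fun V => (∫⋯∫⁻_O, b ∂μ) V * ((∫⋯∫⁻_F, a ∂μ) V / (∫⋯∫⁻_F, (∫⋯∫⁻_O, b ∂μ) ∂μ) V)

/-- the lift is measurable. [textbook] -/
theorem measurable_hybridLift (O F : Finset ι) {b a : (∀ i, X i) → ℝ≥0∞} (hb : Measurable b) (ha : Measurable a) :
    Measurable (hybridLift μ O F b a) :=
  (hb.lmarginal μ).mul ((ha.lmarginal μ).div ((hb.lmarginal μ).lmarginal μ))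

/-- the two iterated fibre integrals of the receiver agree and both equal `∫⋯∫⁻_{O∪F} b`. [textbook] -/
theorem lmarginal_fibre_older_eq {O F : Finset ι} (hOF : Disjoint O F) {b : (∀ i, X i) → ℝ≥0∞} (hb : Measurable b) :
    ∫⋯∫⁻_F, (∫⋯∫⁻_O, b ∂μ) ∂μ = ∫⋯∫⁻_(O ∪ F), b ∂μ :=
  (lmarginal_union' μ b hb hOF).symm

/-- **(L1)** the fibre integral of the lift is the SENDER's fibre integral (b01's `lmarginal_norm_term`). [folklore] -/
theorem lmarginal_fibre_hybridLift (O F : Finset ι) {b a : (∀ i, X i) → ℝ≥0∞} (hb : Measurable b)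
    (h0 : ∀ V, (∫⋯∫⁻_F, (∫⋯∫⁻_O, b ∂μ) ∂μ) V ≠ 0) (htop : ∀ V, (∫⋯∫⁻_F, (∫⋯∫⁻_O, b ∂μ) ∂μ) V ≠ ∞) :
    ∫⋯∫⁻_F, hybridLift μ O F b a ∂μ = ∫⋯∫⁻_F, a ∂μ := by
  unfold hybridLift
  exact lmarginal_norm_term F (indepOf_lmarginal μ F a) (hb.lmarginal μ) h0 htop

/-- **(L1′) = (N)** in integral form: against a test function NOT READING THE FIBRE (older coordinates, same-level off-fibre, …) the
lift integrates like the sender. [folklore] -/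
theorem lintegral_hybridLift_mul_of_indepOf [Fintype ι] (O F : Finset ι) {b a w : (∀ i, X i) → ℝ≥0∞}
    (hb : Measurable b) (ha : Measurable a) (hw : Measurable w) (hwF : IndepOf F w)
    (h0 : ∀ V, (∫⋯∫⁻_F, (∫⋯∫⁻_O, b ∂μ) ∂μ) V ≠ 0) (htop : ∀ V, (∫⋯∫⁻_F, (∫⋯∫⁻_O, b ∂μ) ∂μ) V ≠ ∞) :
    ∫⁻ V, hybridLift μ O F b a V * w V ∂Measure.pi μ = ∫⁻ V, a V * w V ∂Measure.pi μ := by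
  have hL := measurable_hybridLift (μ := μ) O F hb ha
  refine lintegral_eq_of_lmarginal_eq F (hL.mul hw) (ha.mul hw) ?_
  have e1 : (fun V => hybridLift μ O F b a V * w V) = w * hybridLift μ O F b a := by ext V; simp [mul_comm]
  have e2 : (fun V => a V * w V) = w * a := by ext V; simp [mul_comm]
  rw [e1, e2, lmarginal_mul_of_indepOf F hwF hL, lmarginal_mul_of_indepOf F hwF ha, lmarginal_fibre_hybridLift O F hb h0 htop]

/-- **(L4)** the lift has the sender's MASS. [folklore] -/
theorem lintegral_hybridLift [Fintype ι] (O F : Finset ι) {b a : (∀ i, X i) → ℝ≥0∞} (hb : Measurable b) (ha : Measurable a)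
    (h0 : ∀ V, (∫⋯∫⁻_F, (∫⋯∫⁻_O, b ∂μ) ∂μ) V ≠ 0) (htop : ∀ V, (∫⋯∫⁻_F, (∫⋯∫⁻_O, b ∂μ) ∂μ) V ≠ ∞) :
    ∫⁻ V, hybridLift μ O F b a V ∂Measure.pi μ = ∫⁻ V, a V ∂Measure.pi μ := by
  simpa using lintegral_hybridLift_mul_of_indepOf O F hb ha measurable_const (w := fun _ => 1) (fun _ _ => rfl) h0 htop

/-- **(L2)** the OLDER-integral (current-level shadow) of the lift is the PRINTED ℝ-term: the receiver's level density times the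
printed quotient `∫_{O∪F} a ∕ ∫_{O∪F} b` (def-R `rstepOfSel` ∕ b01 `normTerm`). [folklore] -/
theorem lmarginal_older_hybridLift {O F : Finset ι} (hOF : Disjoint O F) {b a : (∀ i, X i) → ℝ≥0∞}
    (hb : Measurable b) (ha : Measurable a) :
    ∫⋯∫⁻_O, hybridLift μ O F b a ∂μ =
      fun V => (∫⋯∫⁻_O, b ∂μ) V * ((∫⋯∫⁻_(O ∪ F), a ∂μ) V / (∫⋯∫⁻_(O ∪ F), b ∂μ) V) := by
  have hD : ∫⋯∫⁻_F, (∫⋯∫⁻_O, b ∂μ) ∂μ = ∫⋯∫⁻_O, (∫⋯∫⁻_F, b ∂μ) ∂μ := by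
    rw [← lmarginal_union' μ b hb hOF, lmarginal_union μ b hb hOF]
  have hind : IndepOf O (fun V => (∫⋯∫⁻_O, b ∂μ) V / (∫⋯∫⁻_F, (∫⋯∫⁻_O, b ∂μ) ∂μ) V) := by
    intro x y
    simp only [hD, indepOf_lmarginal μ O b x y, indepOf_lmarginal μ O (∫⋯∫⁻_F, b ∂μ) x y]
  have e1 : hybridLift μ O F b a
      = (fun V => (∫⋯∫⁻_O, b ∂μ) V / (∫⋯∫⁻_F, (∫⋯∫⁻_O, b ∂μ) ∂μ) V) * ∫⋯∫⁻_F, a ∂μ := by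
    ext V; simp only [hybridLift, Pi.mul_apply, div_eq_mul_inv]; ring
  rw [e1, lmarginal_mul_of_indepOf O hind (ha.lmarginal μ), ← lmarginal_union μ a ha hOF,
    lmarginal_fibre_older_eq hOF hb]
  ext V; simp only [Pi.mul_apply, div_eq_mul_inv]; ring

/-- **(L3) = `hon`** in integral form: against a test function NOT READING THE OLDER COORDINATES (a statistic of the current level) the
lift is dominated by `q̄ ×` the RECEIVER, `q̄` any pointwise bound of the PRINTED quotient (`∫_{O∪F} a ≤ q̄ · ∫_{O∪F} b`). [folklore] -/
theorem lintegral_hybridLift_mul_le [Fintype ι] {O F : Finset ι} (hOF : Disjoint O F) {b a w : (∀ i, X i) → ℝ≥0∞}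
    (hb : Measurable b) (ha : Measurable a) (hw : Measurable w) (hwO : IndepOf O w) {q : ℝ≥0∞}
    (hq : ∀ V, (∫⋯∫⁻_(O ∪ F), a ∂μ) V ≤ q * (∫⋯∫⁻_(O ∪ F), b ∂μ) V) :
    ∫⁻ V, hybridLift μ O F b a V * w V ∂Measure.pi μ ≤ q * ∫⁻ V, b V * w V ∂Measure.pi μ := by
  have hL := measurable_hybridLift (μ := μ) O F hb ha
  rw [← lintegral_const_mul q (show Measurable (fun V => b V * w V) from hb.mul hw)]
  refine lintegral_le_of_lmarginal_le O (hL.mul hw) (measurable_const.mul (hb.mul hw)) ?_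
  have e1 : (fun V => hybridLift μ O F b a V * w V) = w * hybridLift μ O F b a := by ext V; simp [mul_comm]
  have e2 : (fun V => q * (b V * w V)) = (fun V => q * w V) * b := by ext V; simp only [Pi.mul_apply]; ring
  have hqw : IndepOf O (fun V => q * w V) := fun x y => by simp only [hwO x y]
  rw [e1, e2, lmarginal_mul_of_indepOf O hwO hL, lmarginal_mul_of_indepOf O hqw hb, lmarginal_older_hybridLift hOF hb ha]
  intro V
  simp only [Pi.mul_apply]
  have hquot : (∫⋯∫⁻_(O ∪ F), a ∂μ) V / (∫⋯∫⁻_(O ∪ F), b ∂μ) V ≤ q := ENNReal.div_le_of_le_mul (hq V)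
  calc w V * ((∫⋯∫⁻_O, b ∂μ) V * ((∫⋯∫⁻_(O ∪ F), a ∂μ) V / (∫⋯∫⁻_(O ∪ F), b ∂μ) V))
      ≤ w V * ((∫⋯∫⁻_O, b ∂μ) V * q) := by gcongr
    _ = q * w V * (∫⋯∫⁻_O, b ∂μ) V := by ring

/-! ### The two measure forms module 20n's binders want (`hNA` ∕ `hoffA` as EQUALITIES of image laws, `honA` as a domination) -/

/-- a statistic `u` does not read the coordinates in `s`. [folklore] -/
def NotRead (s : Finset ι) (u : (∀ i, X i) → ℝ) : Prop :=
  ∀ (V : ∀ i, X i) (y : ∀ i : s, X i), u (Function.updateFinset V s y) = u V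

omit [∀ i, MeasurableSpace (X i)] in
/-- a statistic not reading `s` has `s`-independent level-set indicators. [folklore] -/
theorem indepOf_indicator_preimage {s : Finset ι} {u : (∀ i, X i) → ℝ} (hu : NotRead s u) (A : Set ℝ) :
    IndepOf s ((u ⁻¹' A).indicator (1 : (∀ i, X i) → ℝ≥0∞)) := by
  intro V y
  by_cases hV : u V ∈ A
  · have hV' : u (Function.updateFinset V s y) ∈ A := by rwa [hu V y]
    rw [Set.indicator_of_mem (show Function.updateFinset V s y ∈ u ⁻¹' A from hV'),
      Set.indicator_of_mem (show V ∈ u ⁻¹' A from hV)]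
    rfl
  · have hV' : u (Function.updateFinset V s y) ∉ A := by rwa [hu V y]
    rw [Set.indicator_of_notMem (show Function.updateFinset V s y ∉ u ⁻¹' A from hV'),
      Set.indicator_of_notMem (show V ∉ u ⁻¹' A from hV)]

/-- `f · 1_B = 1_B f` as functions. [textbook] -/
theorem mul_indicator_one_eq_fun {α : Type*} (f : α → ℝ≥0∞) (B : Set α) :
    (fun V => f V * B.indicator 1 V) = B.indicator f := by
  ext V; by_cases hV : V ∈ B <;> simp [hV]

/-- a set integral as an integral against the indicator weight. [textbook] -/
theorem setLIntegral_eq_lintegral_mul_indicator {α : Type*} [MeasurableSpace α] (ν : Measure α) (f : α → ℝ≥0∞) {B : Set α}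
    (hB : MeasurableSet B) : ∫⁻ V in B, f V ∂ν = ∫⁻ V, f V * B.indicator 1 V ∂ν := by
  rw [← lintegral_indicator hB, mul_indicator_one_eq_fun f B]

/-- **(N) AS 20n WANTS IT** (`hNA` for every past statistic, `hoffA` for a same-level statistic off the fibre): the image law of a
statistic NOT READING THE FIBRE under the lifted term EQUALS its image law under the sender. [folklore] -/
theorem map_hybridLift_eq_of_notRead [Fintype ι] (O F : Finset ι) {b a : (∀ i, X i) → ℝ≥0∞}
    (hb : Measurable b) (ha : Measurable a) {u : (∀ i, X i) → ℝ} (hu : Measurable u) (huF : NotRead F u)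
    (h0 : ∀ V, (∫⋯∫⁻_F, (∫⋯∫⁻_O, b ∂μ) ∂μ) V ≠ 0) (htop : ∀ V, (∫⋯∫⁻_F, (∫⋯∫⁻_O, b ∂μ) ∂μ) V ≠ ∞) :
    ((Measure.pi μ).withDensity (hybridLift μ O F b a)).map u = ((Measure.pi μ).withDensity a).map u := by
  ext A hA
  rw [Measure.map_apply hu hA, Measure.map_apply hu hA, withDensity_apply _ (hu hA), withDensity_apply _ (hu hA),
    setLIntegral_eq_lintegral_mul_indicator _ (hybridLift μ O F b a) (hu hA), setLIntegral_eq_lintegral_mul_indicator _ a (hu hA)]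
  exact lintegral_hybridLift_mul_of_indepOf O F hb ha (measurable_const.indicator (hu hA))
    (indepOf_indicator_preimage huF A) h0 htop

/-- **`hon` AS 20n WANTS IT**: the image law of a CURRENT-LEVEL statistic (not reading the older coordinates) under the lifted term is
dominated by `q̄ •` its image law under the RECEIVER. [folklore] -/
theorem map_hybridLift_le_of_notReadOlder [Fintype ι] {O F : Finset ι} (hOF : Disjoint O F) {b a : (∀ i, X i) → ℝ≥0∞}
    (hb : Measurable b) (ha : Measurable a) {u : (∀ i, X i) → ℝ} (hu : Measurable u) (huO : NotRead O u) {q : ℝ≥0∞}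
    (hq : ∀ V, (∫⋯∫⁻_(O ∪ F), a ∂μ) V ≤ q * (∫⋯∫⁻_(O ∪ F), b ∂μ) V) :
    ((Measure.pi μ).withDensity (hybridLift μ O F b a)).map u ≤ q • ((Measure.pi μ).withDensity b).map u := by
  rw [Measure.le_iff]
  intro A hA
  rw [Measure.smul_apply, smul_eq_mul, Measure.map_apply hu hA, Measure.map_apply hu hA, withDensity_apply _ (hu hA),
    withDensity_apply _ (hu hA), setLIntegral_eq_lintegral_mul_indicator _ (hybridLift μ O F b a) (hu hA),
    setLIntegral_eq_lintegral_mul_indicator _ b (hu hA)]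
  exact lintegral_hybridLift_mul_le hOF hb ha (measurable_const.indicator (hu hA)) (indepOf_indicator_preimage huO A) hq

/-! ### (L5) the younger levels ride on mass-one forward kernels and are invisible to statistics of levels `≤ k`

INSTANTIATION RECIPE (Card 56): on the history space `Π_{j ≤ K}` (level-`j` bond variables, product Haar) the lift of a step-`k` send
is `hybridLift μ O F b a · Φ` with `O` = the bonds of levels `< k`, `F` = the step's fibre bonds (level `k`), `a`, `b` = the sender's
∕ receiver's history densities TRUNCATED at level `k` (not reading the younger coordinates `Y`) and `Φ = Π_{j ≥ k} w_j(V_j, V_{j+1})` the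
COMMON forward-kernel product, of fibrewise mass one.  (Applying `hybridLift` to the untruncated `a·Φ`, `b·Φ` is WRONG: `Φ` reads `F`,
and the younger shadow would be tilted by a `Y`-dependent quotient — census yyyyyy.)  The lemma below is the one line that makes `Φ`
invisible to every statistic of levels `≤ k`, so (L1′)∕(L3)∕(L4) transfer verbatim to the full history space. -/

/-- the marginal of the constant `1` over any coordinate set is `1` (probability reference laws). [textbook] -/
theorem lmarginal_const_one (Y : Finset ι) : (∫⋯∫⁻_Y, (fun _ => (1 : ℝ≥0∞)) ∂μ) = fun _ : (∀ i, X i) => 1 :=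
  lmarginal_of_indepOf Y (fun _ _ => rfl)

/-- **(L5)** a forward factor `Φ` of fibrewise mass one over the younger coordinates `Y` is invisible against any weight not reading
`Y`. [textbook] -/
theorem lintegral_mul_fwd_eq [Fintype ι] (Y : Finset ι) {f Φ : (∀ i, X i) → ℝ≥0∞} (hf : Measurable f) (hΦ : Measurable Φ)
    (hfY : IndepOf Y f) (hΦ1 : ∫⋯∫⁻_Y, Φ ∂μ = fun _ => 1) :
    ∫⁻ V, f V * Φ V ∂Measure.pi μ = ∫⁻ V, f V ∂Measure.pi μ := by
  refine lintegral_eq_of_lmarginal_eq Y (hf.mul hΦ) hf ?_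
  rw [show (fun V => f V * Φ V) = f * Φ from rfl, lmarginal_mul_of_indepOf Y hfY hΦ, hΦ1, lmarginal_of_indepOf Y hfY]
  ext V; simp

/-- **(N) on the full history space**: lift `= hybridLift · Φ`, sender `= a · Φ`; a statistic's weight `w` reading neither the fibre
nor the younger coordinates integrates the same under both. [folklore] -/
theorem lintegral_hybridLift_fwd_mul_of_indepOf [Fintype ι] (O F Y : Finset ι) {b a Φ w : (∀ i, X i) → ℝ≥0∞}
    (hb : Measurable b) (ha : Measurable a) (hΦ : Measurable Φ) (hw : Measurable w)
    (haY : IndepOf Y a) (hLY : IndepOf Y (hybridLift μ O F b a)) (hwF : IndepOf F w) (hwY : IndepOf Y w)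
    (hΦ1 : ∫⋯∫⁻_Y, Φ ∂μ = fun _ => 1)
    (h0 : ∀ V, (∫⋯∫⁻_F, (∫⋯∫⁻_O, b ∂μ) ∂μ) V ≠ 0) (htop : ∀ V, (∫⋯∫⁻_F, (∫⋯∫⁻_O, b ∂μ) ∂μ) V ≠ ∞) :
    ∫⁻ V, hybridLift μ O F b a V * Φ V * w V ∂Measure.pi μ = ∫⁻ V, a V * Φ V * w V ∂Measure.pi μ := by
  have hL := measurable_hybridLift (μ := μ) O F hb ha
  have e1 : ∀ g : (∀ i, X i) → ℝ≥0∞, (fun V => g V * Φ V * w V) = fun V => (g V * w V) * Φ V := fun g => by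
    ext V; ring
  rw [e1, e1, lintegral_mul_fwd_eq Y (f := fun V => hybridLift μ O F b a V * w V) (hL.mul hw) hΦ
      (fun x y => by simp only [hLY x y, hwY x y]) hΦ1,
    lintegral_mul_fwd_eq Y (f := fun V => a V * w V) (ha.mul hw) hΦ (fun x y => by simp only [haY x y, hwY x y]) hΦ1]
  exact lintegral_hybridLift_mul_of_indepOf O F hb ha hw hwF h0 htop

end HybridLift

/-! ## §C  Card 57 — one level's multi-component sender charge is K-uniform by COUNTING -/

section Counting

variable {C : Type*} [DecidableEq C]

/-- the charge of all NONEMPTY component families `S ⊆ U`, each costing `Π_{i∈S} q i`, is `Π_{i∈U}(1+q i) − 1`. [textbook] -/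
theorem senderCharge_eq (U : Finset C) (q : C → ℝ) :
    ∑ S ∈ U.powerset.erase ∅, ∏ i ∈ S, q i = ∏ i ∈ U, (1 + q i) - 1 := by
  rw [Finset.prod_one_add, ← Finset.sum_erase_add _ _ (Finset.empty_mem_powerset U), Finset.prod_empty]
  ring

/-- … hence at most `(1+q̄)^n − 1` when every single-component quotient is `≤ q̄` and the level holds `≤ n` components (live
levels: `n = v₀Λ^{N₁}`, `T4ShellMeasureLevels` l.68): K-UNIFORM with no locality input. [textbook] -/
theorem senderCharge_le_pow (U : Finset C) {q : C → ℝ} {qbar : ℝ} {n : ℕ} (hq0 : ∀ i ∈ U, 0 ≤ q i)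
    (hq : ∀ i ∈ U, q i ≤ qbar) (hn : U.card ≤ n) (hqbar : 0 ≤ qbar) :
    ∑ S ∈ U.powerset.erase ∅, ∏ i ∈ S, q i ≤ (1 + qbar) ^ n - 1 := by
  rw [senderCharge_eq]
  have h1 : ∏ i ∈ U, (1 + q i) ≤ ∏ _i ∈ U, (1 + qbar) :=
    Finset.prod_le_prod (fun i hi => by linarith [hq0 i hi]) (fun i hi => by linarith [hq i hi])
  rw [Finset.prod_const] at h1
  have h2 : (1 + qbar) ^ U.card ≤ (1 + qbar) ^ n := pow_le_pow_right₀ (by linarith) hn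
  linarith

/-- and the sane form of the bound: `(1+q̄)^n − 1 ≤ n·q̄·(1+q̄)^(n-1)`… we only record the crude `≤ (1+q̄)^n`. [textbook] -/
theorem senderCharge_le_pow' (U : Finset C) {q : C → ℝ} {qbar : ℝ} {n : ℕ} (hq0 : ∀ i ∈ U, 0 ≤ q i)
    (hq : ∀ i ∈ U, q i ≤ qbar) (hn : U.card ≤ n) (hqbar : 0 ≤ qbar) :
    1 + ∑ S ∈ U.powerset.erase ∅, ∏ i ∈ S, q i ≤ (1 + qbar) ^ n := by
  have := senderCharge_le_pow U hq0 hq hn hqbar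
  linarith

end Counting

end Summit.QuantumFields.YangMills.Theorems.N21HybridResamplingLift
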